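import Literature.NumberTheory.Automorphic.JacquetShalikaLargeFinset
import Literature.RingTheory.SymmetricFunctions.ShintaniSelfSum
import Literature.NumberTheory.Automorphic.ShintaniWhittakerFormula
import HarnessLib

/-!
# Jacquet–Shalika's (5.3.3) from the boundedness of the unramified Rankin–Selberg torus sums

Trunk `AutomorphicAxiomatic` (G19), topic `NumberTheory/Automorphic`; namespace
`Literature.NumberTheory.Automorphic`. Companion to `JacquetShalikaLargeFinset`, which isolated the
junction **(J)** = `summable_normSq_trace_largeFinset` ((5.3.3)–(5.3.4) of Jacquet–Shalika, *On Euler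
products and the classification of automorphic representations I*, Amer. J. Math. **103** (1981), off
large finite sets of places) through which the named fact `StandardLFunctionData.multipliable_L` of
`AutomorphicLFunction` (loc. cit. Thm. (5.3)) and its partial-product siblings are reached.

The printed proof of (5.3.3) runs through complex analysis: the Rankin–Selberg integral
`Ψ(s) = ∫ φ' φ E(·, Φ, s) = A(s) L_S(s, π × π̄)` is holomorphic on `re s > 1`, hence so is `L_S`
(Lemma (5.2)), and Landau's lemma bounds the abscissa of `log L_S` (p. 556). This file records the
shortcut available **at real points**, where every quantity in sight is non-negative: for `φ' = φ̄`,
`Φ ≥ 0` and real `σ > 1`, unfolding the *finite* integral `Ψ(σ)` (§4) and evaluating the unramified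
local integrals by Shintani's formula (§2; `ShintaniWhittakerFormula`) exhibits the finite partial
products `∏_{v ∈ F} T_v(q_v^{-σ})`, `F ⊆ {v ∉ S}` finite, of the **unramified torus sums**
`T_v(t) = ∑_{λ} |s_λ(x_v)|² t^{|λ|} ∈ [0, ∞]` (`schurSelfSum` of
`Literature.RingTheory.SymmetricFunctions.ShintaniSelfSum`; `x_v` an enumeration of the
Hecke–Satake parameters `α v`, `s_λ` the Schur polynomials) as bounded by the finite number
`Ψ(σ) / A_S(σ)` — an identity of Tonelli type in `[0, ∞]`, needing neither the absolute convergence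
of the Euler product somewhere, nor holomorphy in `s`, nor Landau's lemma, nor the local
non-vanishing results of §1 and §3 of the source. From such a bound, (5.3.3) follows by the
elementary analysis of `ShintaniSelfSum`:

* `summable_normSq_trace_of_schurSelfSum_prod_le` (**proved**): if the finite partial products of
  `v ↦ schurSelfSum (x v) (q_v^{-σ})` off `S` are bounded in `[0, ∞]`, then
  `∑_{v ∉ S} ∑_{k ≥ 1} |tr A_v^k|² / (k q_v^{kσ}) < ∞`. Each `T_v(q_v^{-σ})` is then finite, which forces
  `|x_{v,i}| |x_{v,j}| q_v^{-σ} < 1` (`norm_mul_norm_mul_lt_one_of_schurSelfSum_ne_top`: the finiteness of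
  the self Cauchy sum bounds the parameters), so that Cauchy's identity applies and
  `T_v(q_v^{-σ}) = exp ∑_k |tr A_v^k|² q_v^{-kσ} / k` (`hasSum_of_schurSelfSum_ne_top`); the bound on the
  products is a bound on the partial sums of a series of non-negative terms.
* `JacquetShalika1981_schurSelfSum_prod_bounded` (**named statement**, `def … : Prop`): for every
  cuspidal `Π` there is a finite `S₀` such that for all finite `S ⊇ S₀`, every Satake family `α` of `Π`
  off `S`, every enumeration `x` of it and every real `σ > 1`, the finite partial products of
  `v ↦ T_v(q_v^{-σ})` off `S` are bounded in `[0, ∞]` — the real-point content of §4 + §2 of the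
  source described above. It is **equivalent to (J)**
  (`summable_normSq_trace_largeFinset_of_schurSelfSum_prod_bounded`,
  `JacquetShalika1981_schurSelfSum_prod_bounded_of_largeFinset`), so it is a restatement of
  (5.3.3)–(5.3.4) in the currency the global theory produces, not a stronger claim.
* Consequences: `StandardLFunctionData.multipliable_L_of_schurSelfSum_prod_bounded`,
  `absolutelyConvergent_partialStandardL_of_schurSelfSum_prod_bounded`,
  `multipliable_partialStandardL_of_schurSelfSum_prod_bounded`.

What the global theory has to deliver for `multipliable_L_holds` is thereby reduced to: a non-zero
continuous cusp form `φ ∈ Π` spherical off `S`, the finiteness of `∫ |φ|² E(·, Φ, σ)` over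
`GL_n(K) A_G \ GL_n(𝔸_K)` for `σ > 1` (rapid decay of `φ`, moderate growth of the mirabolic Eisenstein
series of `MirabolicEisensteinSeries`), and the unfolding of that integral (Fourier–Whittaker
expansion, `GlobalWhittakerCoefficient`; the restriction of the global Whittaker coefficient to
`GL_n(K_v)`, `v ∉ S`, being an unramified Whittaker–Hecke datum of `ShintaniWhittakerFormula`) down to
`A_S(σ) · ∏_{v ∉ S} |W_v(1)|⁻² ∑_m q_v^{b(m)} |W_v(ϖ_v^m)|² q_v^{-|m|σ} = A_S(σ) ∏_{v ∉ S} T_v(q_v^{-σ})`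
with `0 < A_S(σ) < ∞` — all at a fixed real `σ`, in `[0, ∞]`.

## References

* H. Jacquet, J. A. Shalika, *On Euler products and the classification of automorphic
  representations I*, Amer. J. Math. 103 (1981), 499–558: §2 (unramified computation), §4 (global
  integrals), Thm. (5.3) and its proof, (5.3.3)–(5.3.4) p. 556 [JacquetShalikaAJM1981].
* J. W. Cogdell, *Analytic theory of L-functions for GL_n*, in: J. Bernstein, S. Gelbart (eds.),
  *An Introduction to the Langlands Program*, Birkhäuser (2004), §2.3, §3 [CogdellAnalyticTheory2004].
* T. Shintani, Proc. Japan Acad. 52 (1976), 180–182; I. G. Macdonald, *Symmetric Functions and Hall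
  Polynomials* (1995), Ch. I (4.3) [Macdonald1995].
-/

noncomputable section

open scoped MatrixGroups ComplexConjugate ENNReal
open NumberField IsDedekindDomain MeasureTheory Complex Filter Topology Finset
open Literature.RingTheory.SymmetricFunctions.SymmPoly

namespace Literature.NumberTheory.Automorphic

/-! ### From bounded torus-sum products to (5.3.3), for one family -/

section OneFamily

variable {K : Type} [Field K] [NumberField K]

/-- Power sums of an enumerated multiset: `∑_{a ∈ α} a^k = ∑_i x_i^k` if `α = {x_i}`. [folklore] -/
theorem multiset_powerSum_eq_sum {m : ℕ} {x : Fin m → ℂ} {α : Multiset ℂ}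
    (hx : (univ : Finset (Fin m)).val.map x = α) (k : ℕ) :
    (α.map (· ^ k)).sum = ∑ i, x i ^ k := by
  rw [← hx, Multiset.map_map]
  rfl

/-- `a (q^{-σ})^{k+1} / (k+1) = a / ((k+1) q^{(k+1)σ})` for `q > 0`. [folklore] -/
theorem mul_rpow_neg_pow_div_eq {q : ℝ} (hq : 0 < q) (σ a : ℝ) (k : ℕ) :
    a * (q ^ (-σ)) ^ (k + 1) / (k + 1) = a / ((k + 1 : ℝ) * q ^ ((k + 1 : ℝ) * σ)) := by
  have h : (q ^ (-σ)) ^ (k + 1) = (q ^ ((k + 1 : ℝ) * σ))⁻¹ := by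
    rw [← Real.rpow_natCast, ← Real.rpow_mul hq.le, ← Real.rpow_neg hq.le]
    congr 1
    push_cast
    ring
  have hpos : 0 < q ^ ((k + 1 : ℝ) * σ) := Real.rpow_pos_of_pos hq _
  rw [h]
  field_simp

/-- **Bounded torus-sum products give (5.3.3).** Let `α` be a family of multisets off a set `S` of
finite places of `K`, enumerated as `α v = {x_{v,i}}` (`x v : Fin m → ℂ`), and `σ` real. If the finite
partial products of `v ↦ T_v = schurSelfSum (x v) (q_v^{-σ}) ∈ [0, ∞]` over `v ∉ S` are bounded by
some `C < ∞`, then `∑_{v ∉ S} ∑_{k ≥ 1} |∑_i x_{v,i}^k|² / (k q_v^{kσ}) < ∞`. Proof: each `T_v ≤ C`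
is finite, so `|x_{v,i}| |x_{v,j}| q_v^{-σ} < 1` and `T_v = exp G_v`,
`G_v = ∑_k |p_k(x_v)|² q_v^{-kσ} / k ≥ 0` (`hasSum_of_schurSelfSum_ne_top`, Cauchy's identity), and
`∑_{v ∈ F} G_v = log ∏_{v ∈ F} T_v ≤ log C` for every finite `F`; a series of non-negative terms
with bounded partial sums converges, and so does the double series (Tonelli). [folklore] -/
theorem summable_normSq_trace_of_schurSelfSum_prod_le {S : Set (HeightOneSpectrum (𝓞 K))}
    {α : SatakeFamily K} {m : ℕ} (x : {v : HeightOneSpectrum (𝓞 K) // v ∉ S} → Fin m → ℂ)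
    (hx : ∀ v, (univ : Finset (Fin m)).val.map (x v) = α v.1) {σ : ℝ} {C : ℝ≥0∞} (hC : C ≠ ⊤)
    (hle : ∀ F : Finset {v : HeightOneSpectrum (𝓞 K) // v ∉ S},
      ∏ v ∈ F, schurSelfSum (x v) ((v.1.residueCard : ℝ) ^ (-σ)) ≤ C) :
    Summable fun kv : ℕ × {v : HeightOneSpectrum (𝓞 K) // v ∉ S} =>
      ‖((α kv.2.1).map (· ^ (kv.1 + 1))).sum‖ ^ 2 /
        ((kv.1 + 1 : ℝ) * (kv.2.1.residueCard : ℝ) ^ ((kv.1 + 1 : ℝ) * σ)) := by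
  -- notation: `t v = q_v^{-σ} ≥ 0`, the local series `g (k, v)` and its sum `G v`
  have ht0 : ∀ v : {v : HeightOneSpectrum (𝓞 K) // v ∉ S}, (0 : ℝ) ≤ (v.1.residueCard : ℝ) ^ (-σ) :=
    fun v => Real.rpow_nonneg (Nat.cast_nonneg _) _
  let g : ℕ × {v : HeightOneSpectrum (𝓞 K) // v ∉ S} → ℝ := fun kv =>
    ‖∑ i, x kv.2 i ^ (kv.1 + 1)‖ ^ 2 * ((kv.2.1.residueCard : ℝ) ^ (-σ)) ^ (kv.1 + 1) / (kv.1 + 1)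
  have hg0 : ∀ kv, 0 ≤ g kv := fun kv => by positivity
  -- each torus sum is finite, hence an exponential
  have hfin : ∀ v : {v : HeightOneSpectrum (𝓞 K) // v ∉ S},
      schurSelfSum (x v) ((v.1.residueCard : ℝ) ^ (-σ)) ≠ ⊤ := by
    intro v
    have h1 := hle {v}
    rw [Finset.prod_singleton] at h1
    exact ne_top_of_le_ne_top hC h1
  have hex : ∀ v : {v : HeightOneSpectrum (𝓞 K) // v ∉ S}, ∃ G : ℝ,
      HasSum (fun k : ℕ => ‖∑ i, x v i ^ (k + 1)‖ ^ 2 * ((v.1.residueCard : ℝ) ^ (-σ)) ^ (k + 1) /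
        (k + 1)) G ∧
        schurSelfSum (x v) ((v.1.residueCard : ℝ) ^ (-σ)) = ENNReal.ofReal (Real.exp G) :=
    fun v => hasSum_of_schurSelfSum_ne_top (x v) (ht0 v) (hfin v)
  choose G hG hGeq using hex
  have hGg : ∀ v, HasSum (fun k : ℕ => g (k, v)) (G v) := fun v => by
    simp only [g]
    exact hG v
  have hG0 : ∀ v, 0 ≤ G v := fun v => (hGg v).nonneg fun k => hg0 (k, v)
  -- bounded partial sums of `G`
  have hC0 : 0 < C.toReal := by
    have h1 := hle ∅
    rw [Finset.prod_empty] at h1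
    have h2 : ENNReal.ofReal 1 ≤ C := by rwa [ENNReal.ofReal_one]
    have h3 : (1 : ℝ) ≤ C.toReal := (ENNReal.ofReal_le_iff_le_toReal hC).mp h2
    linarith
  have hpartial : ∀ F : Finset {v : HeightOneSpectrum (𝓞 K) // v ∉ S},
      ∑ v ∈ F, G v ≤ Real.log C.toReal := by
    intro F
    rw [Real.le_log_iff_exp_le hC0, Real.exp_sum, ← ENNReal.ofReal_le_iff_le_toReal hC,
      ENNReal.ofReal_prod_of_nonneg fun v _ => (Real.exp_pos _).le]
    calc ∏ v ∈ F, ENNReal.ofReal (Real.exp (G v))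
          = ∏ v ∈ F, schurSelfSum (x v) ((v.1.residueCard : ℝ) ^ (-σ)) :=
          Finset.prod_congr rfl fun v _ => (hGeq v).symm
      _ ≤ C := hle F
  have hGsum : Summable G := summable_of_sum_le hG0 hpartial
  -- Tonelli for the double series
  have hprod : Summable fun p : {v : HeightOneSpectrum (𝓞 K) // v ∉ S} × ℕ => g (p.2, p.1) := by
    refine (summable_prod_of_nonneg fun p => hg0 (p.2, p.1)).mpr ⟨fun v => (hGg v).summable, ?_⟩
    exact hGsum.congr fun v => (hGg v).tsum_eq.symm
  have hg : Summable fun kv : ℕ × {v : HeightOneSpectrum (𝓞 K) // v ∉ S} => g (kv.1, kv.2) :=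
    hprod.prod_symm
  -- identify the terms
  refine hg.congr fun kv => ?_
  obtain ⟨k, v⟩ := kv
  have hq0 : (0 : ℝ) < v.1.residueCard := by
    exact_mod_cast (zero_lt_one.trans v.1.one_lt_residueCard)
  simp only [g, multiset_powerSum_eq_sum (hx v)]
  exact mul_rpow_neg_pow_div_eq hq0 σ _ k

end OneFamily

/-! ### The named statement and its equivalence with (J) -/

section Cuspidal

variable {n : ℕ} {K : Type} [Field K] [NumberField K]
  {μ : Measure (AdelicGroupData.gl n K).automorphicQuotient}
  [(AdelicGroupData.gl n K).IsAutomorphicMeasure μ]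

/-- **Boundedness of the unramified Rankin–Selberg torus sums at real points** (the content, at real
`s = σ > 1`, of Jacquet–Shalika (1981), §4 — the integral `Ψ(s, W̄, W, Φ) = ∫ φ̄ φ E(·, Φ, s)` of a
cusp form in `π` against the mirabolic Eisenstein series converges for `re s > 1` and factors over the
places — together with §2, the unramified computation
`Ψ_v(s, W̄_v, W_v, 𝟙) = |W_v(1)|² ∑_λ |s_λ(x_v)|² q_v^{-|λ|s}` by Shintani's formula and Cauchy's identity
(`ShintaniWhittakerFormula`, `CauchyIdentityAnalytic`; Cogdell (2004), §2.3, §3)). For every (unitary)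
cuspidal automorphic representation `Π` of `GL_n(𝔸_K)` there is a finite set `S₀` of finite places such
that for every finite `S ⊇ S₀`, every Satake family `α` of `Π` off `S`, every enumeration
`α v = {x_{v,1}, …, x_{v,n}}` (`v ∉ S`) and every real `σ > 1`, the finite partial products
`∏_{v ∈ F} T_v(q_v^{-σ})`, `F ⊆ {v ∉ S}` finite, of the torus sums
`T_v(t) = ∑_N (∑_{λ antitone, |λ| = N} |s_λ(x_v)|²) t^N ∈ [0, ∞]` (`schurSelfSum`) are bounded by a
finite constant — in the source, by `Ψ(σ) / A_S(σ)` with `A_S(σ) > 0` the product of the local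
integrals at `v ∈ S` of non-negative integrands. Equivalent to (5.3.3)–(5.3.4) off large finite sets
(`summable_normSq_trace_largeFinset_of_schurSelfSum_prod_bounded`,
`JacquetShalika1981_schurSelfSum_prod_bounded_of_largeFinset`); recorded in this currency because it is
what the unfolding at a real point produces, in `[0, ∞]`, before any convergence is known.
[cite: JacquetShalikaAJM1981, §4 and §2; Thm. (5.3), proof, (5.3.3)–(5.3.4), p. 556] -/
def JacquetShalika1981_schurSelfSum_prod_bounded : Prop :=
  ∀ (P : CuspidalAutomorphicRepGL n K μ), ∃ S₀ : Finset (HeightOneSpectrum (𝓞 K)),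
    ∀ ⦃S : Finset (HeightOneSpectrum (𝓞 K))⦄ ⦃α : SatakeFamily K⦄, S₀ ⊆ S →
      IsSatakeFamilyOf P ↑S α →
        ∀ (x : {v : HeightOneSpectrum (𝓞 K) // v ∉ (↑S : Set _)} → Fin n → ℂ),
          (∀ v, (univ : Finset (Fin n)).val.map (x v) = α v.1) → ∀ ⦃σ : ℝ⦄, 1 < σ →
            ∃ C : ℝ≥0∞, C ≠ ⊤ ∧ ∀ F : Finset {v : HeightOneSpectrum (𝓞 K) // v ∉ (↑S : Set _)},
              ∏ v ∈ F, schurSelfSum (x v) ((v.1.residueCard : ℝ) ^ (-σ)) ≤ C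

/-- **(J) from bounded torus-sum products**: `summable_normSq_trace_largeFinset` follows from
`JacquetShalika1981_schurSelfSum_prod_bounded` (enumerate each `α v`, `v ∉ S`, which has `n` elements
by `IsSatakeFamilyOf.card_eq`, and apply `summable_normSq_trace_of_schurSelfSum_prod_le`).
[cite: JacquetShalikaAJM1981, Thm. (5.3), proof, (5.3.3)–(5.3.4)] -/
theorem summable_normSq_trace_largeFinset_of_schurSelfSum_prod_bounded
    (h : JacquetShalika1981_schurSelfSum_prod_bounded (μ := μ)) :
    summable_normSq_trace_largeFinset (μ := μ) := by
  intro P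
  obtain ⟨S₀, hS₀⟩ := h P
  refine ⟨S₀, fun S α hS hα σ hσ => ?_⟩
  have hex : ∀ v : {v : HeightOneSpectrum (𝓞 K) // v ∉ (↑S : Set _)},
      ∃ x : Fin n → ℂ, (univ : Finset (Fin n)).val.map x = α v.1 :=
    fun v => exists_univ_val_map_eq (hα.card_eq v.2)
  choose x hx using hex
  obtain ⟨C, hC, hle⟩ := hS₀ hS hα x hx hσ
  exact summable_normSq_trace_of_schurSelfSum_prod_le x hx hC hle

/-- **Bounded torus-sum products from (J)** (the converse): off `S ⊇ S₀`, (J) gives (5.1.3)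
(`norm_le_sqrt_of_summable_normSq_trace`), so `|x_{v,i}| |x_{v,j}| q_v^{-σ} ≤ q_v^{1-σ} < 1` and
`T_v(q_v^{-σ}) = exp G_v` with `G_v = ∑_k |tr A_v^k|² q_v^{-kσ}/k` (`schurSelfSum_eq_ofReal_exp`), whence
`∏_{v ∈ F} T_v(q_v^{-σ}) = exp ∑_{v ∈ F} G_v ≤ exp ∑_{v ∉ S} G_v < ∞`, the last series converging by
(J) (Tonelli). Hence the named statement is equivalent to (J). [folklore] -/
theorem JacquetShalika1981_schurSelfSum_prod_bounded_of_largeFinset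
    (h : summable_normSq_trace_largeFinset (μ := μ)) :
    JacquetShalika1981_schurSelfSum_prod_bounded (μ := μ) := by
  intro P
  obtain ⟨S₀, hS₀⟩ := h P
  refine ⟨S₀, fun S α hS hα x hx σ hσ => ?_⟩
  have hsum := hS₀ hS hα hσ
  have hsqrt : ∀ v : {v : HeightOneSpectrum (𝓞 K) // v ∉ (↑S : Set _)}, ∀ i,
      ‖x v i‖ ≤ Real.sqrt v.1.residueCard := by
    intro v i
    refine norm_le_sqrt_of_summable_normSq_trace (fun σ' hσ' => hS₀ hS hα hσ') v.2 ?_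
    rw [← hx v]
    exact Multiset.mem_map_of_mem _ (Finset.mem_univ_val i)
  have ht0 : ∀ v : {v : HeightOneSpectrum (𝓞 K) // v ∉ (↑S : Set _)},
      (0 : ℝ) ≤ (v.1.residueCard : ℝ) ^ (-σ) :=
    fun v => Real.rpow_nonneg (Nat.cast_nonneg _) _
  have hsmall : ∀ v : {v : HeightOneSpectrum (𝓞 K) // v ∉ (↑S : Set _)}, ∀ i j,
      ‖x v i‖ * ‖x v j‖ * (v.1.residueCard : ℝ) ^ (-σ) < 1 := by
    intro v i j
    have hq1 : (1 : ℝ) < v.1.residueCard := by exact_mod_cast v.1.one_lt_residueCard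
    have hq0 : (0 : ℝ) < v.1.residueCard := zero_lt_one.trans hq1
    calc ‖x v i‖ * ‖x v j‖ * (v.1.residueCard : ℝ) ^ (-σ)
          ≤ Real.sqrt v.1.residueCard * Real.sqrt v.1.residueCard * (v.1.residueCard : ℝ) ^ (-σ) :=
          mul_le_mul_of_nonneg_right (mul_le_mul (hsqrt v i) (hsqrt v j) (norm_nonneg _)
            (Real.sqrt_nonneg _)) (ht0 v)
      _ = (v.1.residueCard : ℝ) ^ (1 - σ) := by
          rw [Real.mul_self_sqrt hq0.le, show (1 - σ : ℝ) = 1 + -σ by ring, Real.rpow_add hq0,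
            Real.rpow_one]
      _ < 1 := Real.rpow_lt_one_of_one_lt_of_neg hq1 (by linarith)
  -- the local series and their sums
  let g : ℕ × {v : HeightOneSpectrum (𝓞 K) // v ∉ (↑S : Set _)} → ℝ := fun kv =>
    ‖∑ i, x kv.2 i ^ (kv.1 + 1)‖ ^ 2 * ((kv.2.1.residueCard : ℝ) ^ (-σ)) ^ (kv.1 + 1) / (kv.1 + 1)
  have hg0 : ∀ kv, 0 ≤ g kv := fun kv => by positivity
  have hg : Summable g := by
    refine hsum.congr fun kv => ?_
    obtain ⟨k, v⟩ := kv
    have hq0 : (0 : ℝ) < v.1.residueCard := by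
      exact_mod_cast (zero_lt_one.trans v.1.one_lt_residueCard)
    show _ = g (k, v)
    simp only [g, multiset_powerSum_eq_sum (hx v)]
    exact (mul_rpow_neg_pow_div_eq hq0 σ _ k).symm
  have hprod : Summable fun p : {v : HeightOneSpectrum (𝓞 K) // v ∉ (↑S : Set _)} × ℕ =>
      g (p.2, p.1) :=
    hg.prod_symm
  obtain ⟨-, hGsum⟩ := (summable_prod_of_nonneg fun p => hg0 (p.2, p.1)).mp hprod
  have hG0 : ∀ v : {v : HeightOneSpectrum (𝓞 K) // v ∉ (↑S : Set _)}, 0 ≤ ∑' k : ℕ, g (k, v) :=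
    fun v => tsum_nonneg fun k => hg0 (k, v)
  refine ⟨ENNReal.ofReal (Real.exp (∑' v, ∑' k : ℕ, g (k, v))), ENNReal.ofReal_ne_top, fun F => ?_⟩
  have hTv : ∀ v : {v : HeightOneSpectrum (𝓞 K) // v ∉ (↑S : Set _)},
      schurSelfSum (x v) ((v.1.residueCard : ℝ) ^ (-σ)) =
        ENNReal.ofReal (Real.exp (∑' k : ℕ, g (k, v))) :=
    fun v => schurSelfSum_eq_ofReal_exp (x v) (ht0 v) (hsmall v)
  calc ∏ v ∈ F, schurSelfSum (x v) ((v.1.residueCard : ℝ) ^ (-σ))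
        = ∏ v ∈ F, ENNReal.ofReal (Real.exp (∑' k : ℕ, g (k, v))) :=
        Finset.prod_congr rfl fun v _ => hTv v
    _ = ENNReal.ofReal (Real.exp (∑ v ∈ F, ∑' k : ℕ, g (k, v))) := by
        rw [Real.exp_sum, ENNReal.ofReal_prod_of_nonneg fun v _ => (Real.exp_pos _).le]
    _ ≤ ENNReal.ofReal (Real.exp (∑' v, ∑' k : ℕ, g (k, v))) :=
        ENNReal.ofReal_le_ofReal (Real.exp_le_exp.mpr (hGsum.sum_le_tsum F fun v _ => hG0 v))

/-- **`multipliable_L` from bounded torus-sum products** (Jacquet–Shalika's Thm. (5.3) for the full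
standard Euler product of every datum `D` of a cuspidal `Π`, via (J) and
`StandardLFunctionData.multipliable_L_of_largeFinset`). [cite: JacquetShalikaAJM1981, Thm. (5.3)] -/
theorem StandardLFunctionData.multipliable_L_of_schurSelfSum_prod_bounded
    {P : CuspidalAutomorphicRepGL n K μ} (h : JacquetShalika1981_schurSelfSum_prod_bounded (μ := μ)) :
    StandardLFunctionData.multipliable_L (P := P) :=
  StandardLFunctionData.multipliable_L_of_largeFinset
    (summable_normSq_trace_largeFinset_of_schurSelfSum_prod_bounded h)

/-- `absolutelyConvergent_partialStandardL` from bounded torus-sum products (Thm. (5.3) with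
Remark (5.4), arbitrary exceptional set; the Flath input is discharged).
[cite: JacquetShalikaAJM1981, Thm. (5.3), Remark (5.4)] -/
theorem absolutelyConvergent_partialStandardL_of_schurSelfSum_prod_bounded
    (h : JacquetShalika1981_schurSelfSum_prod_bounded (μ := μ)) :
    absolutelyConvergent_partialStandardL (μ := μ) :=
  absolutelyConvergent_partialStandardL_of_largeFinset
    (summable_normSq_trace_largeFinset_of_schurSelfSum_prod_bounded h)

/-- `multipliable_partialStandardL` from bounded torus-sum products.
[cite: JacquetShalikaAJM1981, Thm. (5.3)] -/
theorem multipliable_partialStandardL_of_schurSelfSum_prod_bounded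
    (h : JacquetShalika1981_schurSelfSum_prod_bounded (μ := μ)) :
    multipliable_partialStandardL (μ := μ) :=
  multipliable_partialStandardL_of_largeFinset
    (summable_normSq_trace_largeFinset_of_schurSelfSum_prod_bounded h)

/-- The splitting `L_eq_partialStandardL_mul` from bounded torus-sum products. [folklore] -/
theorem StandardLFunctionData.L_eq_partialStandardL_mul_of_schurSelfSum_prod_bounded
    {P : CuspidalAutomorphicRepGL n K μ} (h : JacquetShalika1981_schurSelfSum_prod_bounded (μ := μ)) :
    StandardLFunctionData.L_eq_partialStandardL_mul (P := P) :=
  StandardLFunctionData.L_eq_partialStandardL_mul_of_largeFinset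
    (summable_normSq_trace_largeFinset_of_schurSelfSum_prod_bounded h)

end Cuspidal

end Literature.NumberTheory.Automorphic
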